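import Mathlib.Analysis.Analytic.Order
import Mathlib.Analysis.Analytic.IsolatedZeros
import Mathlib.Analysis.Calculus.IteratedDeriv.Lemmas
import Mathlib.Analysis.Calculus.Deriv.MeanValue
import Mathlib.Data.Sign.Basic
import HarnessLib

/-!
# Critical zeros of real-analytic functions: the Fourier–Hurwitz–Ki–Kim count

Support file (real-variable part) for the discharge of
`Literature.Analysis.Complex.KiKim2000_thm_4_3_noCriticalPoints`
(`Literature/Analysis/Complex/FourierPolyaKiKim.lean`; H. Ki, Y.-O. Kim, *On the number of
nonreal zeros of real entire functions and the Fourier–Pólya conjecture*, Duke Math. J. 104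
(2000) 45–73).

For a real-analytic `f` on an interval and `λ ≥ 1`, Ki–Kim (following Fourier and Hurwitz 1912)
attach to every zero `c` of `f^{(λ)}` of multiplicity `m` a number `k` of *critical zeros*
((1.1), p. 46) and prove the counting formula ((3.1), p. 54; [H2, pp. 585–587])

  `2 K_{[a,b]}(f^{(λ)}) = N_{[a,b]}(f^{(λ)}) − N_{[a,b]}(f^{(λ−1)}) − ½ [sg(f^{(λ−1)}f^{(λ)})(a) − sg(f^{(λ−1)}f^{(λ)})(b)]`

(`N` = number of zeros with multiplicity, `f^{(λ-1)} f^{(λ)} ≠ 0` at `a, b`). We formalize this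
for real-analytic `F : ℝ → ℝ` (analytic at every point of `ℝ`) in the following form, which avoids
defining `k` separately: with `N = zeroCount` (a `finsum` of `analyticOrderNatAt` over `[a, b]`)
and `s = sign (F F')`, the integer

  `fourK F a b := 2 N(F') − 2 N(F) − (s(a) − s(b))`   ( = `4K` of (3.1) )

is shown (`fourK_nonneg_dvd_iff`) to be a sum of local contributions `tau F c` over the zeros of
`F F'` in `(a, b)`, each `≥ 0`, divisible by `4`, and `= 0` exactly when `c` is not a critical
zero of `F'`; in particular `fourK ≥ 0`, `4 ∣ fourK`, and `fourK = 0` iff every zero `c` of `F'`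
in `(a, b)` with `F(c) ≠ 0` is simple with `F(c) F''(c) < 0` (the case `k = 0` of (1.1): `m`
odd, `m = 1`, `f^{(l-1)}(c) f^{(l+m)}(c) < 0`). The proof is the one behind (1.1)/(3.1): the
one-sided signs of `F F'` (= the direction of `|F|`) telescope over the finitely many zeros of
`F F'` (`sum_sgnL_sub_sgnR`); at a zero of `F` they are `(−, +)`, at a zero of `F'` of order `m`
with `F ≠ 0` they are `((−1)^m ρ, ρ)`, `ρ = sign (F F^{(m+1)})`, and `N(F') − N(F)` is computed
pointwise from `ord(F') = ord(F) − 1` at zeros of `F` (Mathlib's `analyticOrderAt_deriv_add_one`).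

Also here: the level sums of (3.3) (`sum_fourK_iteratedDeriv`, Budan–Fourier–Hurwitz telescoping),
Rolle's theorem with multiplicities as the corollary `fourK ≥ 0` (`zeroCount_le_zeroCount_deriv_add_one`),
and elementary evaluations of `zeroCount` (zero-free margins, a simple zero, multiplication by `t^k`).

Design: signs are Mathlib's `SignType.sign`, cast to `ℤ` inside `fourK`; one-sided signs
`sgnR`/`sgnL` are defined by an `if` on eventual positivity and characterised for analytic
functions of finite order by the first non-vanishing derivative (`sgnR_eq_sign_iteratedDeriv`,
`sgnL_eq_sign_iteratedDeriv`). Nothing here is specific to entire functions; the transfer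
theorems (Thm 3.2 of Ki–Kim, multiplication by `x`) and the semicontinuity of critical points
(Thm 3.1) are in `FourierPolyaKiKimTransfer.lean`.

## References

* H. Ki, Y.-O. Kim, Duke Math. J. 104 (2000) 45–73, (1.1) p. 46, (3.1)–(3.3) pp. 54–55 [KiKim2000].
* A. Hurwitz, *Über den Satz von Budan–Fourier*, Math. Ann. 71 (1912) 584–591 (cited through [KiKim2000, §3]).
-/

noncomputable section

open Filter Set Topology
open scoped Topology

namespace Literature.Analysis.Complex
namespace KiKim

variable {F : ℝ → ℝ} {c : ℝ}

/-! ## Leading coefficient and the iterated derivative -/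

/-- Leibniz at a centred monomial: `((t - c)^q g(t))^{(q)}(c) = q! g(c)`. [folklore] -/
theorem iteratedDeriv_centeredPow_mul {g : ℝ → ℝ} {q : ℕ} (hg : ContDiffAt ℝ q g c) :
    iteratedDeriv q (fun t => (t - c) ^ q * g t) c = q.factorial * g c := by
  have h1 : ContDiffAt ℝ q (fun t : ℝ => (t - c) ^ q) c := by fun_prop
  have := iteratedDeriv_mul (n := q) (x := c) h1 hg
  have hfun : ((fun t : ℝ => (t - c) ^ q) * g) = fun t => (t - c) ^ q * g t := rfl
  rw [hfun] at this
  rw [this, Finset.sum_eq_single q]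
  · have hp : iteratedDeriv q (fun t : ℝ => (t - c) ^ q) c = q.factorial := by
      have := iteratedDeriv_comp_sub_const q (fun x : ℝ => x ^ q) c
      rw [this]
      simp [Nat.descFactorial_self]
    rw [hp]
    simp
  · intro i hi hiq
    have hi' : i < q := lt_of_le_of_ne (Nat.lt_succ_iff.mp (Finset.mem_range.mp hi)) hiq
    have hp : iteratedDeriv i (fun t : ℝ => (t - c) ^ q) c = 0 := by
      have := iteratedDeriv_comp_sub_const i (fun x : ℝ => x ^ q) c
      rw [this]
      simp only [sub_self, iteratedDeriv_fun_pow_zero, if_neg hi'.ne]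
      push_cast; ring
    rw [hp]; simp
  · intro h; exact absurd (Finset.self_mem_range_succ q) h

/-- If `F = (t - c)^q • g` near `c` with `g` analytic at `c`, then `F^{(q)}(c) = q! g(c)`. [folklore] -/
theorem iteratedDeriv_eq_factorial_mul_of_eventuallyEq {g : ℝ → ℝ} {q : ℕ} (hg : AnalyticAt ℝ g c)
    (h : ∀ᶠ t in 𝓝 c, F t = (t - c) ^ q • g t) :
    iteratedDeriv q F c = q.factorial * g c := by
  have h' : F =ᶠ[𝓝 c] fun t => (t - c) ^ q * g t := by
    filter_upwards [h] with t ht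
    rw [ht, smul_eq_mul]
  rw [h'.iteratedDeriv_eq q]
  exact iteratedDeriv_centeredPow_mul (hg.contDiffAt.of_le le_top)

/-- The `q`-th derivative at a zero of (finite) order `q` does not vanish, and lower ones do. [folklore] -/
theorem iteratedDeriv_analyticOrder_ne_zero (hF : AnalyticAt ℝ F c) {q : ℕ}
    (hq : analyticOrderAt F c = q) : iteratedDeriv q F c ≠ 0 :=
  ((analyticOrderAt_eq_nat_iff_iteratedDeriv_eq_zero hF).mp hq).2

/-! ## One-sided signs of a real-analytic function -/

/-- Near `c` on the right, an analytic `F` of finite order `q` at `c` has the sign of `F^{(q)}(c)`. [folklore] -/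
theorem eventually_nhdsGT_sign_eq (hF : AnalyticAt ℝ F c) {q : ℕ} (hq : analyticOrderAt F c = q) :
    ∀ᶠ t in 𝓝[>] c, SignType.sign (F t) = SignType.sign (iteratedDeriv q F c) := by
  obtain ⟨g, hg, hg0, hfg⟩ := hF.analyticOrderAt_eq_natCast.mp hq
  have hlead := iteratedDeriv_eq_factorial_mul_of_eventuallyEq hg hfg
  have hsg : ∀ᶠ t in 𝓝 c, SignType.sign (g t) = SignType.sign (g c) := by
    rcases lt_or_gt_of_ne hg0 with h | h
    · filter_upwards [hg.continuousAt.eventually_lt continuousAt_const h] with t ht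
      rw [sign_neg ht, sign_neg h]
    · filter_upwards [continuousAt_const.eventually_lt hg.continuousAt h] with t ht
      rw [sign_pos ht, sign_pos h]
  have h1 : ∀ᶠ t in 𝓝[>] c, F t = (t - c) ^ q • g t ∧ SignType.sign (g t) = SignType.sign (g c) :=
    (hfg.and hsg).filter_mono nhdsWithin_le_nhds
  filter_upwards [h1, self_mem_nhdsWithin] with t ht htc
  rw [ht.1, smul_eq_mul, sign_mul, hlead, sign_mul, ht.2]
  have hpos : 0 < (t - c) ^ q := pow_pos (sub_pos.mpr htc) q
  rw [sign_pos hpos, one_mul, sign_pos (by positivity : (0:ℝ) < q.factorial), one_mul]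

/-- Near `c` on the left, an analytic `F` of finite order `q` at `c` has the sign `(-1)^q sign F^{(q)}(c)`. [folklore] -/
theorem eventually_nhdsLT_sign_eq (hF : AnalyticAt ℝ F c) {q : ℕ} (hq : analyticOrderAt F c = q) :
    ∀ᶠ t in 𝓝[<] c, SignType.sign (F t) = (-1) ^ q * SignType.sign (iteratedDeriv q F c) := by
  obtain ⟨g, hg, hg0, hfg⟩ := hF.analyticOrderAt_eq_natCast.mp hq
  have hlead := iteratedDeriv_eq_factorial_mul_of_eventuallyEq hg hfg
  have hsg : ∀ᶠ t in 𝓝 c, SignType.sign (g t) = SignType.sign (g c) := by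
    rcases lt_or_gt_of_ne hg0 with h | h
    · filter_upwards [hg.continuousAt.eventually_lt continuousAt_const h] with t ht
      rw [sign_neg ht, sign_neg h]
    · filter_upwards [continuousAt_const.eventually_lt hg.continuousAt h] with t ht
      rw [sign_pos ht, sign_pos h]
  have h1 : ∀ᶠ t in 𝓝[<] c, F t = (t - c) ^ q • g t ∧ SignType.sign (g t) = SignType.sign (g c) :=
    (hfg.and hsg).filter_mono nhdsWithin_le_nhds
  filter_upwards [h1, self_mem_nhdsWithin] with t ht htc
  rw [ht.1, smul_eq_mul, sign_mul, hlead, sign_mul, ht.2, sign_pow]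
  have hneg : t - c < 0 := sub_neg.mpr htc
  rw [sign_neg hneg, sign_pos (by positivity : (0:ℝ) < q.factorial), one_mul]


/-- The sign of `F` immediately to the right of `c`: `1` if `F > 0` there eventually, else `-1`. [folklore] -/
def sgnR (F : ℝ → ℝ) (c : ℝ) : SignType := by
  classical exact if ∀ᶠ t in 𝓝[>] c, 0 < F t then 1 else -1

/-- The sign of `F` immediately to the left of `c`: `1` if `F > 0` there eventually, else `-1`. [folklore] -/
def sgnL (F : ℝ → ℝ) (c : ℝ) : SignType := by
  classical exact if ∀ᶠ t in 𝓝[<] c, 0 < F t then 1 else -1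

/-- `sgnR` takes only the values `±1`. [folklore] -/
theorem sgnR_ne_zero (F : ℝ → ℝ) (c : ℝ) : sgnR F c ≠ 0 := by
  unfold sgnR; split_ifs <;> decide

/-- `sgnL` takes only the values `±1`. [folklore] -/
theorem sgnL_ne_zero (F : ℝ → ℝ) (c : ℝ) : sgnL F c ≠ 0 := by
  unfold sgnL; split_ifs <;> decide

/-- If `sign F = s ≠ 0` eventually on the right of `c`, then `sgnR F c = s`. [folklore] -/
theorem sgnR_eq_of_eventually {s : SignType} (hs : s ≠ 0)
    (h : ∀ᶠ t in 𝓝[>] c, SignType.sign (F t) = s) : sgnR F c = s := by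
  unfold sgnR
  rcases s with _ | _ | _
  · exact absurd rfl hs
  · rw [if_neg]
    · rfl
    · intro h'
      have : ∀ᶠ t in 𝓝[>] c, False := by
        filter_upwards [h, h'] with t ht ht'
        rw [sign_pos ht'] at ht
        exact absurd ht (by decide)
      exact (Filter.eventually_false_iff_eq_bot.mp this) ▸ (inferInstance : (𝓝[>] c).NeBot) |>.ne rfl
  · rw [if_pos]
    · rfl
    · filter_upwards [h] with t ht
      exact sign_eq_one_iff.mp ht

/-- If `sign F = s ≠ 0` eventually on the left of `c`, then `sgnL F c = s`. [folklore] -/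
theorem sgnL_eq_of_eventually {s : SignType} (hs : s ≠ 0)
    (h : ∀ᶠ t in 𝓝[<] c, SignType.sign (F t) = s) : sgnL F c = s := by
  unfold sgnL
  rcases s with _ | _ | _
  · exact absurd rfl hs
  · rw [if_neg]
    · rfl
    · intro h'
      have : ∀ᶠ t in 𝓝[<] c, False := by
        filter_upwards [h, h'] with t ht ht'
        rw [sign_pos ht'] at ht
        exact absurd ht (by decide)
      exact (Filter.eventually_false_iff_eq_bot.mp this) ▸ (inferInstance : (𝓝[<] c).NeBot) |>.ne rfl
  · rw [if_pos]
    · rfl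
    · filter_upwards [h] with t ht
      exact sign_eq_one_iff.mp ht

/-- Formula for the right sign at a point of finite order `q`. [folklore] -/
theorem sgnR_eq_sign_iteratedDeriv (hF : AnalyticAt ℝ F c) {q : ℕ} (hq : analyticOrderAt F c = q) :
    sgnR F c = SignType.sign (iteratedDeriv q F c) :=
  sgnR_eq_of_eventually (sign_ne_zero.mpr (iteratedDeriv_analyticOrder_ne_zero hF hq))
    (eventually_nhdsGT_sign_eq hF hq)

/-- Formula for the left sign at a point of finite order `q`. [folklore] -/
theorem sgnL_eq_sign_iteratedDeriv (hF : AnalyticAt ℝ F c) {q : ℕ} (hq : analyticOrderAt F c = q) :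
    sgnL F c = (-1) ^ q * SignType.sign (iteratedDeriv q F c) :=
  sgnL_eq_of_eventually (mul_ne_zero (pow_ne_zero _ (by decide))
    (sign_ne_zero.mpr (iteratedDeriv_analyticOrder_ne_zero hF hq))) (eventually_nhdsLT_sign_eq hF hq)

/-- The right sign is the eventual sign on the right. [folklore] -/
theorem eventually_sign_eq_sgnR (hF : AnalyticAt ℝ F c) (hq : analyticOrderAt F c ≠ ⊤) :
    ∀ᶠ t in 𝓝[>] c, SignType.sign (F t) = sgnR F c := by
  obtain ⟨q, hq⟩ := ENat.ne_top_iff_exists.mp hq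
  rw [sgnR_eq_sign_iteratedDeriv hF hq.symm]
  exact eventually_nhdsGT_sign_eq hF hq.symm

/-- The left sign is the eventual sign on the left. [folklore] -/
theorem eventually_sign_eq_sgnL (hF : AnalyticAt ℝ F c) (hq : analyticOrderAt F c ≠ ⊤) :
    ∀ᶠ t in 𝓝[<] c, SignType.sign (F t) = sgnL F c := by
  obtain ⟨q, hq⟩ := ENat.ne_top_iff_exists.mp hq
  rw [sgnL_eq_sign_iteratedDeriv hF hq.symm]
  exact eventually_nhdsLT_sign_eq hF hq.symm

/-- At a point where `F c ≠ 0` both one-sided signs are `sign (F c)`. [folklore] -/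
theorem sgnR_eq_sign_of_ne_zero (hF : AnalyticAt ℝ F c) (h0 : F c ≠ 0) :
    sgnR F c = SignType.sign (F c) := by
  have hq : analyticOrderAt F c = (0 : ℕ) := by
    rw [Nat.cast_zero, hF.analyticOrderAt_eq_zero]; exact h0
  rw [sgnR_eq_sign_iteratedDeriv hF hq, iteratedDeriv_zero]

/-- At a point where `F c ≠ 0` the left sign is `sign (F c)`. [folklore] -/
theorem sgnL_eq_sign_of_ne_zero (hF : AnalyticAt ℝ F c) (h0 : F c ≠ 0) :
    sgnL F c = SignType.sign (F c) := by
  have hq : analyticOrderAt F c = (0 : ℕ) := by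
    rw [Nat.cast_zero, hF.analyticOrderAt_eq_zero]; exact h0
  rw [sgnL_eq_sign_iteratedDeriv hF hq, iteratedDeriv_zero, pow_zero, one_mul]

/-- Product rule for right signs. [folklore] -/
theorem sgnR_mul {G : ℝ → ℝ} (hF : AnalyticAt ℝ F c) (hG : AnalyticAt ℝ G c)
    (hFq : analyticOrderAt F c ≠ ⊤) (hGq : analyticOrderAt G c ≠ ⊤) :
    sgnR (fun t => F t * G t) c = sgnR F c * sgnR G c := by
  apply sgnR_eq_of_eventually (mul_ne_zero (sgnR_ne_zero F c) (sgnR_ne_zero G c))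
  filter_upwards [eventually_sign_eq_sgnR hF hFq, eventually_sign_eq_sgnR hG hGq] with t h1 h2
  rw [sign_mul, h1, h2]

/-- Product rule for left signs. [folklore] -/
theorem sgnL_mul {G : ℝ → ℝ} (hF : AnalyticAt ℝ F c) (hG : AnalyticAt ℝ G c)
    (hFq : analyticOrderAt F c ≠ ⊤) (hGq : analyticOrderAt G c ≠ ⊤) :
    sgnL (fun t => F t * G t) c = sgnL F c * sgnL G c := by
  apply sgnL_eq_of_eventually (mul_ne_zero (sgnL_ne_zero F c) (sgnL_ne_zero G c))
  filter_upwards [eventually_sign_eq_sgnL hF hFq, eventually_sign_eq_sgnL hG hGq] with t h1 h2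
  rw [sign_mul, h1, h2]

/-! ## The direction of `|F|`: one-sided signs of `F · F'` -/

section direction

variable (hF : AnalyticAt ℝ F c) (hq : analyticOrderAt F c ≠ ⊤)
include hF hq

/-- At a zero of finite order the derivative has finite order. [folklore] -/
theorem analyticOrderAt_deriv_ne_top_of_eq_zero (h0 : F c = 0) : analyticOrderAt (deriv F) c ≠ ⊤ := by
  intro h
  exact hq ((analyticOrderAt_deriv_eq_top_iff_of_eq_zero hF h0).mp h)

/-- **At a zero** of `F` (of finite order), `F F' < 0` just left and `F F' > 0` just right:
`|F|` decreases into the zero and increases out of it. [folklore] -/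
theorem sgnR_mul_deriv_of_eq_zero (h0 : F c = 0) : sgnR (fun t => F t * deriv F t) c = 1 := by
  obtain ⟨μ, hμ⟩ := ENat.ne_top_iff_exists.mp hq
  have hμ' : analyticOrderAt F c = μ := hμ.symm
  have hμ0 : μ ≠ 0 := by
    rintro rfl
    rw [Nat.cast_zero, hF.analyticOrderAt_eq_zero] at hμ'
    exact hμ' h0
  obtain ⟨ν, rfl⟩ := Nat.exists_eq_succ_of_ne_zero hμ0
  have hd : analyticOrderAt (deriv F) c = ν := analyticOrderAt_deriv_of_pos hF (by exact_mod_cast hμ')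
  rw [sgnR_mul hF hF.deriv hq (by rw [hd]; exact ENat.coe_ne_top ν),
    sgnR_eq_sign_iteratedDeriv hF hμ', sgnR_eq_sign_iteratedDeriv hF.deriv hd,
    ← iteratedDeriv_succ', Nat.succ_eq_add_one]
  have hne := iteratedDeriv_analyticOrder_ne_zero hF hμ'
  rcases lt_or_gt_of_ne hne with h | h
  · rw [sign_neg h]; decide
  · rw [sign_pos h]; decide

/-- **At a zero** of `F` (of finite order), `F F' < 0` just to the left. [folklore] -/
theorem sgnL_mul_deriv_of_eq_zero (h0 : F c = 0) : sgnL (fun t => F t * deriv F t) c = -1 := by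
  obtain ⟨μ, hμ⟩ := ENat.ne_top_iff_exists.mp hq
  have hμ' : analyticOrderAt F c = μ := hμ.symm
  have hμ0 : μ ≠ 0 := by
    rintro rfl
    rw [Nat.cast_zero, hF.analyticOrderAt_eq_zero] at hμ'
    exact hμ' h0
  obtain ⟨ν, rfl⟩ := Nat.exists_eq_succ_of_ne_zero hμ0
  have hd : analyticOrderAt (deriv F) c = ν := analyticOrderAt_deriv_of_pos hF (by exact_mod_cast hμ')
  rw [sgnL_mul hF hF.deriv hq (by rw [hd]; exact ENat.coe_ne_top ν),
    sgnL_eq_sign_iteratedDeriv hF hμ', sgnL_eq_sign_iteratedDeriv hF.deriv hd,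
    ← iteratedDeriv_succ', Nat.succ_eq_add_one]
  have hne := iteratedDeriv_analyticOrder_ne_zero hF hμ'
  set S := SignType.sign (iteratedDeriv (ν + 1) F c) with hS
  have hSS : S * S = 1 := by
    rcases lt_or_gt_of_ne hne with h | h
    · rw [hS, sign_neg h]; decide
    · rw [hS, sign_pos h]; decide
  rw [mul_mul_mul_comm, ← pow_add, hSS, mul_one, show ν + 1 + ν = 2 * ν + 1 by ring, pow_succ,
    pow_mul, show (-1 : SignType) ^ 2 = 1 by decide, one_pow, one_mul]

end direction


/-! ## Zeros of real-analytic functions on compact intervals -/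

/-- A real-analytic function on `ℝ` which is not identically zero has finite order everywhere. [folklore] -/
theorem analyticOrderAt_ne_top_of_ne_zero (hF : ∀ x, AnalyticAt ℝ F x) (hne : F ≠ 0) (x : ℝ) :
    analyticOrderAt F x ≠ ⊤ := fun h => hne ((AnalyticOnNhd.analyticOrderAt_eq_top_iff_eq_zero x hF).mp h)

/-- The zeros of a real-analytic `F ≢ 0` in a compact interval form a finite set. [folklore] -/
theorem finite_zeros_Icc (hF : ∀ x, AnalyticAt ℝ F x) (hne : F ≠ 0) (a b : ℝ) :
    {x | x ∈ Icc a b ∧ F x = 0}.Finite := by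
  by_contra hinf
  obtain ⟨x, -, hx⟩ := (Set.not_finite.mp hinf : Set.Infinite _).exists_accPt_of_subset_isCompact
    isCompact_Icc (fun y hy => hy.1)
  have hfr : ∃ᶠ y in 𝓝[≠] x, F y = 0 :=
    (accPt_iff_frequently_nhdsNE.mp hx).mono fun y hy => hy.2
  have hev := (hF x).frequently_zero_iff_eventually_zero.mp hfr
  exact analyticOrderAt_ne_top_of_ne_zero hF hne x (analyticOrderAt_eq_top.mpr hev)

/-- The number of zeros of `F` in `[a, b]`, counted with multiplicity (analytic order). [cite: KiKim2000, §3 p. 54] -/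
def zeroCount (F : ℝ → ℝ) (a b : ℝ) : ℕ := ∑ᶠ x ∈ Icc a b, analyticOrderNatAt F x

/-- `zeroCount` as a finite sum over any finite subset of `[a, b]` containing the zeros. [folklore] -/
theorem zeroCount_eq_sum {a b : ℝ} {S : Finset ℝ} (hS : ↑S ⊆ Icc a b)
    (hZ : ∀ x ∈ Icc a b, F x = 0 → x ∈ S) : zeroCount F a b = ∑ x ∈ S, analyticOrderNatAt F x := by
  apply finsum_mem_eq_sum_of_subset _ _ hS
  rintro x ⟨hx, hsupp⟩
  exact hZ x hx (apply_eq_zero_of_analyticOrderNatAt_ne_zero hsupp)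

/-- A continuous function without zeros on an open interval has constant sign there. [folklore] -/
theorem sign_eq_sign_of_ne_zero {Φ : ℝ → ℝ} {a b : ℝ} (hc : ContinuousOn Φ (Ioo a b))
    (h0 : ∀ x ∈ Ioo a b, Φ x ≠ 0) {x y : ℝ} (hx : x ∈ Ioo a b) (hy : y ∈ Ioo a b) :
    SignType.sign (Φ x) = SignType.sign (Φ y) := by
  have key : ∀ u ∈ Ioo a b, ∀ v ∈ Ioo a b, ¬ (Φ u < 0 ∧ 0 < Φ v) := by
    intro u hu v hv ⟨hu', hv'⟩
    obtain ⟨z, hz, hz0⟩ := isPreconnected_Ioo.intermediate_value hu hv hc ⟨hu'.le, hv'.le⟩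
    exact h0 z hz hz0
  rcases lt_trichotomy (Φ x) 0 with h1 | h1 | h1 <;> rcases lt_trichotomy (Φ y) 0 with h2 | h2 | h2
  · rw [sign_neg h1, sign_neg h2]
  · exact absurd h2 (h0 y hy)
  · exact absurd ⟨h1, h2⟩ (key x hx y hy)
  · exact absurd h1 (h0 x hx)
  · exact absurd h1 (h0 x hx)
  · exact absurd h1 (h0 x hx)
  · exact absurd ⟨h2, h1⟩ (key y hy x hx)
  · exact absurd h2 (h0 y hy)
  · rw [sign_pos h1, sign_pos h2]

/-- On a zero-free open interval the one-sided signs at the ends and inside all agree with the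
sign of the function. [folklore] -/
theorem signs_of_no_zero {Φ : ℝ → ℝ} (hΦ : ∀ x, AnalyticAt ℝ Φ x) {a b : ℝ} (hab : a < b)
    (h0 : ∀ x ∈ Ioo a b, Φ x ≠ 0) :
    ∃ σ : SignType, σ ≠ 0 ∧ sgnR Φ a = σ ∧ sgnL Φ b = σ ∧
      ∀ x ∈ Ioo a b, sgnL Φ x = σ ∧ sgnR Φ x = σ := by
  have hc : ContinuousOn Φ (Ioo a b) := fun x _ => (hΦ x).continuousAt.continuousWithinAt
  set m := (a + b) / 2 with hm
  have hmI : m ∈ Ioo a b := ⟨by rw [hm]; linarith, by rw [hm]; linarith⟩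
  refine ⟨SignType.sign (Φ m), sign_ne_zero.mpr (h0 m hmI), ?_, ?_, ?_⟩
  · apply sgnR_eq_of_eventually (sign_ne_zero.mpr (h0 m hmI))
    filter_upwards [Ioo_mem_nhdsGT hab] with t ht
    exact sign_eq_sign_of_ne_zero hc h0 ht hmI
  · apply sgnL_eq_of_eventually (sign_ne_zero.mpr (h0 m hmI))
    filter_upwards [Ioo_mem_nhdsLT hab] with t ht
    exact sign_eq_sign_of_ne_zero hc h0 ht hmI
  · intro x hx
    constructor
    · apply sgnL_eq_of_eventually (sign_ne_zero.mpr (h0 m hmI))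
      filter_upwards [Ioo_mem_nhdsLT hx.1] with t ht
      exact sign_eq_sign_of_ne_zero hc h0 ⟨ht.1, ht.2.trans hx.2⟩ hmI
    · apply sgnR_eq_of_eventually (sign_ne_zero.mpr (h0 m hmI))
      filter_upwards [Ioo_mem_nhdsGT hx.2] with t ht
      exact sign_eq_sign_of_ne_zero hc h0 ⟨hx.1.trans ht.1, ht.2⟩ hmI

/-- **Telescoping of the one-sided signs.** For a real-analytic `Φ` and a finite set `S ⊆ (a, b)`
containing all zeros of `Φ` in `(a, b)`:
`Σ_{x ∈ S} (sgnL Φ x - sgnR Φ x) = sgnR Φ a - sgnL Φ b`. [cite: KiKim2000, (3.1)] -/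
theorem sum_sgnL_sub_sgnR {Φ : ℝ → ℝ} (hΦ : ∀ x, AnalyticAt ℝ Φ x) :
    ∀ (n : ℕ) (S : Finset ℝ), S.card = n → ∀ a b : ℝ, a < b → (∀ x ∈ S, a < x ∧ x < b) →
      (∀ x, a < x → x < b → Φ x = 0 → x ∈ S) →
      ∑ x ∈ S, ((sgnL Φ x : ℤ) - sgnR Φ x) = (sgnR Φ a : ℤ) - sgnL Φ b := by
  intro n
  induction n using Nat.strong_induction_on with
  | _ n ih =>
  intro S hS a b hab hSin hZ
  by_cases hz : ∃ p, a < p ∧ p < b ∧ Φ p = 0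
  · obtain ⟨p, hap, hpb, hp0⟩ := hz
    have hpS : p ∈ S := hZ p hap hpb hp0
    classical
    set T₁ := (S.erase p).filter (· < p) with hT₁
    set T₂ := (S.erase p).filter (fun x => ¬ x < p) with hT₂
    have hcard : (S.erase p).card < n := by
      rw [Finset.card_erase_of_mem hpS, hS]
      exact Nat.sub_one_lt (by rw [← hS]; exact Finset.card_ne_zero.mpr ⟨p, hpS⟩)
    have h1 : ∑ x ∈ T₁, ((sgnL Φ x : ℤ) - sgnR Φ x) = (sgnR Φ a : ℤ) - sgnL Φ p := by
      refine ih T₁.card ((Finset.card_filter_le _ _).trans_lt hcard) T₁ rfl a p hap ?_ ?_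
      · intro x hx
        rw [hT₁, Finset.mem_filter, Finset.mem_erase] at hx
        exact ⟨(hSin x hx.1.2).1, hx.2⟩
      · intro x hax hxp hx0
        rw [hT₁, Finset.mem_filter, Finset.mem_erase]
        exact ⟨⟨hxp.ne, hZ x hax (hxp.trans hpb) hx0⟩, hxp⟩
    have h2 : ∑ x ∈ T₂, ((sgnL Φ x : ℤ) - sgnR Φ x) = (sgnR Φ p : ℤ) - sgnL Φ b := by
      refine ih T₂.card ((Finset.card_filter_le _ _).trans_lt hcard) T₂ rfl p b hpb ?_ ?_
      · intro x hx
        rw [hT₂, Finset.mem_filter, Finset.mem_erase] at hx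
        exact ⟨lt_of_le_of_ne (not_lt.mp hx.2) (Ne.symm hx.1.1), (hSin x hx.1.2).2⟩
      · intro x hpx hxb hx0
        rw [hT₂, Finset.mem_filter, Finset.mem_erase]
        exact ⟨⟨hpx.ne', hZ x (hap.trans hpx) hxb hx0⟩, not_lt.mpr hpx.le⟩
    rw [← Finset.add_sum_erase S _ hpS, ← Finset.sum_filter_add_sum_filter_not (S.erase p) (· < p),
      ← hT₁, ← hT₂, h1, h2]
    ring
  · push Not at hz
    have h0 : ∀ x ∈ Ioo a b, Φ x ≠ 0 := fun x hx => hz x hx.1 hx.2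
    obtain ⟨σ, -, ha, hb, hin⟩ := signs_of_no_zero hΦ hab h0
    rw [ha, hb, sub_self]
    refine Finset.sum_eq_zero fun x hx => ?_
    obtain ⟨h1, h2⟩ := hin x (hSin x hx)
    rw [h1, h2, sub_self]


/-! ## The critical-zero count of Fourier–Hurwitz–Ki–Kim: `4K = 2N(F') - 2N(F) - (s(a) - s(b))` -/

/-- `s(x) = sign (F(x) F'(x))`, as an integer. [cite: KiKim2000, (3.1)] -/
def sFF (F : ℝ → ℝ) (x : ℝ) : ℤ := SignType.sign (F x * deriv F x)

/-- **Four times the number of critical zeros of `F'` in `[a, b]`** (Ki–Kim 2000, (1.1) and (3.1);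
Hurwitz 1912): `fourK F a b = 2 N_{[a,b]}(F') - 2 N_{[a,b]}(F) - (s(a) - s(b))`, `s = sign (F F')`.
The structure theorem `fourK_nonneg_dvd_iff` shows that this is `4 Σ k` with `k`
as in (1.1), in particular `≥ 0`, divisible by `4`, and `= 0` iff `F'` has no critical zeros. [cite: KiKim2000, (1.1) and (3.1)] -/
def fourK (F : ℝ → ℝ) (a b : ℝ) : ℤ :=
  2 * (zeroCount (deriv F) a b : ℤ) - 2 * (zeroCount F a b : ℤ) - (sFF F a - sFF F b)

/-- The local contribution of a point to `fourK`. [cite: KiKim2000, (1.1)] -/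
def tau (F : ℝ → ℝ) (x : ℝ) : ℤ :=
  2 * (analyticOrderNatAt (deriv F) x : ℤ) - 2 * (analyticOrderNatAt F x : ℤ) -
    ((sgnL (fun t => F t * deriv F t) x : ℤ) - sgnR (fun t => F t * deriv F t) x)

/-- A function with non-zero derivative is not the zero function. [folklore] -/
theorem ne_zero_of_deriv_ne_zero (hF' : deriv F ≠ 0) : F ≠ 0 := by
  rintro rfl; exact hF' deriv_zero

/-- A non-zero sign is `±1` in `ℤ`. [folklore] -/
theorem signType_coe_int_eq_or (s : SignType) (hs : s ≠ 0) : (s : ℤ) = 1 ∨ (s : ℤ) = -1 := by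
  rcases s with _ | _ | _
  · exact absurd rfl hs
  · right; rfl
  · left; rfl

/-- The cast `SignType → ℤ` is injective. [folklore] -/
theorem signType_eq_of_coe_int_eq {s t : SignType} (h : (s : ℤ) = t) : s = t := by
  revert h; rcases s with _ | _ | _ <;> rcases t with _ | _ | _ <;> decide

/-- **Pointwise structure of `fourK`.** The local contribution `tau F x` is `≥ 0`, divisible by `4`,
and vanishes iff `x` is not a critical zero of `F'` in the sense of (1.1) with `k ≥ 1`, i.e. iff
(`F'(x) = 0`, `F(x) ≠ 0` ⟹ `F(x) F''(x) < 0`). [cite: KiKim2000, (1.1) and (3.1)] -/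
theorem tau_nonneg_dvd_iff (hF : ∀ x, AnalyticAt ℝ F x) (hF' : deriv F ≠ 0) (x : ℝ) :
    0 ≤ tau F x ∧ 4 ∣ tau F x ∧
      (tau F x = 0 ↔ (deriv F x = 0 → F x ≠ 0 → F x * deriv (deriv F) x < 0)) := by
  have hFne : F ≠ 0 := ne_zero_of_deriv_ne_zero hF'
  have hdF : ∀ y, AnalyticAt ℝ (deriv F) y := fun y => (hF y).deriv
  have hoF : analyticOrderAt F x ≠ ⊤ := analyticOrderAt_ne_top_of_ne_zero hF hFne x
  have hoF' : analyticOrderAt (deriv F) x ≠ ⊤ := analyticOrderAt_ne_top_of_ne_zero hdF hF' x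
  unfold tau
  by_cases h0 : F x = 0
  · -- a zero of `F`
    obtain ⟨μ, hμ⟩ := ENat.ne_top_iff_exists.mp hoF
    have hμ' : analyticOrderAt F x = μ := hμ.symm
    have hμ0 : μ ≠ 0 := by
      rintro rfl
      rw [Nat.cast_zero, (hF x).analyticOrderAt_eq_zero] at hμ'
      exact hμ' h0
    obtain ⟨ν, rfl⟩ := Nat.exists_eq_succ_of_ne_zero hμ0
    have hd : analyticOrderAt (deriv F) x = ν :=
      analyticOrderAt_deriv_of_pos (hF x) (by exact_mod_cast hμ')
    have h1 : analyticOrderNatAt F x = ν + 1 := by simp [analyticOrderNatAt, hμ']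
    have h2 : analyticOrderNatAt (deriv F) x = ν := by simp [analyticOrderNatAt, hd]
    rw [h1, h2, sgnL_mul_deriv_of_eq_zero (hF x) hoF h0, sgnR_mul_deriv_of_eq_zero (hF x) hoF h0,
      SignType.coe_neg_one, SignType.coe_one]
    refine ⟨by push_cast; omega, ⟨0, by push_cast; ring⟩, ?_⟩
    simp only [h0, ne_eq, not_true_eq_false, IsEmpty.forall_iff, implies_true, iff_true]
    push_cast; ring
  · have h1 : analyticOrderNatAt F x = 0 := by
      simp [analyticOrderNatAt, (hF x).analyticOrderAt_eq_zero.mpr h0]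
    rw [h1]
    by_cases h0' : deriv F x = 0
    · -- a zero of `F'` that is not a zero of `F`
      obtain ⟨m, hm⟩ := ENat.ne_top_iff_exists.mp hoF'
      have hm' : analyticOrderAt (deriv F) x = m := hm.symm
      have hm0 : m ≠ 0 := by
        rintro rfl
        rw [Nat.cast_zero, (hdF x).analyticOrderAt_eq_zero] at hm'
        exact hm' h0'
      have h2 : analyticOrderNatAt (deriv F) x = m := by simp [analyticOrderNatAt, hm']
      have hder := (analyticOrderAt_eq_nat_iff_iteratedDeriv_eq_zero (hdF x)).mp hm'
      set ρ : SignType := SignType.sign (F x) * SignType.sign (iteratedDeriv m (deriv F) x) with hρ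
      have hρ0 : ρ ≠ 0 := mul_ne_zero (sign_ne_zero.mpr h0) (sign_ne_zero.mpr hder.2)
      have hR : sgnR (fun t => F t * deriv F t) x = ρ := by
        rw [sgnR_mul (hF x) (hdF x) hoF hoF', sgnR_eq_sign_of_ne_zero (hF x) h0,
          sgnR_eq_sign_iteratedDeriv (hdF x) hm']
      have hL : sgnL (fun t => F t * deriv F t) x = (-1) ^ m * ρ := by
        rw [sgnL_mul (hF x) (hdF x) hoF hoF', sgnL_eq_sign_of_ne_zero (hF x) h0,
          sgnL_eq_sign_iteratedDeriv (hdF x) hm', hρ]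
        simp only [mul_left_comm]
      have hcast : (((-1 : SignType) ^ m * ρ : SignType) : ℤ) = (-1) ^ m * (ρ : ℤ) := by
        rw [SignType.coe_mul, SignType.coe_pow, SignType.coe_neg_one]
      rw [h2, hR, hL, hcast]
      simp only [Nat.cast_zero, mul_zero, sub_zero]
      -- the second derivative vanishes unless `m = 1`
      have hF'' : m ≠ 1 → deriv (deriv F) x = 0 := by
        intro hm1
        have := hder.1 1 (by omega)
        rwa [iteratedDeriv_one] at this
      -- and for `m = 1`, `ρ` is the sign of `F F''`
      have hρ1 : m = 1 → ρ = SignType.sign (F x * deriv (deriv F) x) := by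
        rintro rfl
        rw [hρ, iteratedDeriv_one, sign_mul]
      rcases signType_coe_int_eq_or ρ hρ0 with hρi | hρi <;> rw [hρi]
      · -- ρ = 1: `|F|` increases out of `x`
        rcases Nat.even_or_odd m with he | ho
        · rw [he.neg_one_pow]
          obtain ⟨j, rfl⟩ := he
          refine ⟨by omega, by omega, ⟨fun h => by exfalso; omega, fun h => ?_⟩⟩
          exfalso
          have := h h0' h0
          rw [hF'' (by omega), mul_zero] at this
          exact lt_irrefl _ this
        · rw [ho.neg_one_pow]
          obtain ⟨j, rfl⟩ := ho
          refine ⟨by omega, by omega, ⟨fun h => by exfalso; omega, fun h => ?_⟩⟩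
          exfalso
          have := h h0' h0
          by_cases hj : j = 0
          · subst hj
            have h3 : ρ = 1 := signType_eq_of_coe_int_eq (by rw [hρi]; rfl)
            rw [hρ1 (by ring)] at h3
            exact absurd (sign_eq_one_iff.mp h3) (not_lt.mpr this.le)
          · rw [hF'' (by omega), mul_zero] at this
            exact lt_irrefl _ this
      · -- ρ = -1: `|F|` decreases out of `x`
        rcases Nat.even_or_odd m with he | ho
        · rw [he.neg_one_pow]
          obtain ⟨j, rfl⟩ := he
          refine ⟨by omega, by omega, ⟨fun h => by exfalso; omega, fun h => ?_⟩⟩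
          exfalso
          have := h h0' h0
          rw [hF'' (by omega), mul_zero] at this
          exact lt_irrefl _ this
        · rw [ho.neg_one_pow]
          obtain ⟨j, rfl⟩ := ho
          refine ⟨by omega, by omega, ⟨fun h _ _ => ?_, fun h => ?_⟩⟩
          · have hj : j = 0 := by omega
            subst hj
            have h3 : ρ = -1 := signType_eq_of_coe_int_eq (by rw [hρi]; rfl)
            rw [hρ1 (by ring)] at h3
            exact sign_eq_neg_one_iff.mp h3
          · have := h h0' h0
            by_cases hj : j = 0
            · subst hj; norm_num
            · rw [hF'' (by omega), mul_zero] at this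
              exact absurd this (lt_irrefl 0)
    · -- a regular point
      have h2 : analyticOrderNatAt (deriv F) x = 0 := by
        simp [analyticOrderNatAt, (hdF x).analyticOrderAt_eq_zero.mpr h0']
      have hΦ : AnalyticAt ℝ (fun t => F t * deriv F t) x := (hF x).mul (hdF x)
      have hΦ0 : F x * deriv F x ≠ 0 := mul_ne_zero h0 h0'
      rw [h2, sgnL_eq_sign_of_ne_zero hΦ hΦ0, sgnR_eq_sign_of_ne_zero hΦ hΦ0]
      simp [h0']


/-- **Structure theorem for `fourK`** (Ki–Kim 2000, (1.1) & (3.1)): for real-analytic `F` with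
`F' ≢ 0` and `F F' ≠ 0` at `a < b`, `fourK F a b` is `≥ 0`, divisible by `4`, and vanishes iff
`F'` has no critical zero in `(a, b)`: every zero `c ∈ (a, b)` of `F'` with `F(c) ≠ 0` is simple
with `F(c) F''(c) < 0`. [cite: KiKim2000, (3.1)] -/
theorem fourK_nonneg_dvd_iff (hF : ∀ x, AnalyticAt ℝ F x) (hF' : deriv F ≠ 0) {a b : ℝ}
    (hab : a < b) (ha : F a ≠ 0) (ha' : deriv F a ≠ 0) (hb : F b ≠ 0) (hb' : deriv F b ≠ 0) :
    0 ≤ fourK F a b ∧ 4 ∣ fourK F a b ∧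
      (fourK F a b = 0 ↔ ∀ c ∈ Ioo a b, deriv F c = 0 → F c ≠ 0 → F c * deriv (deriv F) c < 0) := by
  classical
  have hFne : F ≠ 0 := ne_zero_of_deriv_ne_zero hF'
  have hdF : ∀ y, AnalyticAt ℝ (deriv F) y := fun y => (hF y).deriv
  set S : Finset ℝ := (finite_zeros_Icc hF hFne a b).toFinset ∪ (finite_zeros_Icc hdF hF' a b).toFinset
    with hS
  have hmemS : ∀ x, x ∈ S ↔ x ∈ Icc a b ∧ (F x = 0 ∨ deriv F x = 0) := by
    intro x
    rw [hS, Finset.mem_union, Set.Finite.mem_toFinset, Set.Finite.mem_toFinset]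
    simp only [mem_setOf_eq]
    tauto
  have hSsub : (↑S : Set ℝ) ⊆ Icc a b := fun x hx => ((hmemS x).mp hx).1
  have hSIoo : ∀ x ∈ S, a < x ∧ x < b := by
    intro x hx
    obtain ⟨⟨hax, hxb⟩, h0⟩ := (hmemS x).mp hx
    refine ⟨lt_of_le_of_ne hax ?_, lt_of_le_of_ne hxb ?_⟩
    · rintro rfl; rcases h0 with h | h
      · exact ha h
      · exact ha' h
    · rintro rfl; rcases h0 with h | h
      · exact hb h
      · exact hb' h
  have hN : zeroCount F a b = ∑ x ∈ S, analyticOrderNatAt F x :=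
    zeroCount_eq_sum hSsub fun x hx h0 => (hmemS x).mpr ⟨hx, Or.inl h0⟩
  have hN' : zeroCount (deriv F) a b = ∑ x ∈ S, analyticOrderNatAt (deriv F) x :=
    zeroCount_eq_sum hSsub fun x hx h0 => (hmemS x).mpr ⟨hx, Or.inr h0⟩
  have hΦ : ∀ x, AnalyticAt ℝ (fun t => F t * deriv F t) x := fun x => (hF x).mul (hdF x)
  have hT := sum_sgnL_sub_sgnR hΦ S.card S rfl a b hab hSIoo (fun x hax hxb hx0 =>
    (hmemS x).mpr ⟨⟨hax.le, hxb.le⟩, mul_eq_zero.mp hx0⟩)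
  rw [sgnR_eq_sign_of_ne_zero (hΦ a) (mul_ne_zero ha ha'),
    sgnL_eq_sign_of_ne_zero (hΦ b) (mul_ne_zero hb hb')] at hT
  have hsum : fourK F a b = ∑ x ∈ S, tau F x := by
    unfold fourK sFF tau
    rw [hN, hN', ← hT]
    push_cast
    simp only [Finset.sum_sub_distrib, Finset.mul_sum]
  have hτ := fun x => tau_nonneg_dvd_iff hF hF' x
  rw [hsum]
  refine ⟨Finset.sum_nonneg fun x _ => (hτ x).1, Finset.dvd_sum fun x _ => (hτ x).2.1, ?_⟩
  rw [Finset.sum_eq_zero_iff_of_nonneg fun x _ => (hτ x).1]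
  constructor
  · intro h c hc hc' hc0
    by_cases hcS : c ∈ S
    · exact ((hτ c).2.2.mp (h c hcS)) hc' hc0
    · exact absurd ((hmemS c).mpr ⟨⟨hc.1.le, hc.2.le⟩, Or.inr hc'⟩) hcS
  · intro h x hx
    exact (hτ x).2.2.mpr (h x (hSIoo x hx))

/-! ## Sums over consecutive levels (Budan–Fourier–Hurwitz, Ki–Kim (3.3)) -/

/-- `(F^{(n)})' = F^{(n+1)}`. [folklore] -/
theorem deriv_iteratedDeriv (F : ℝ → ℝ) (n : ℕ) : deriv (iteratedDeriv n F) = iteratedDeriv (n + 1) F :=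
  (iteratedDeriv_succ (n := n) (f := F)).symm

/-- **Level telescoping.** `Σ_{i < n} fourK(F^{(l+i)}) = 2 N(F^{(l+n)}) - 2 N(F^{(l)}) -
Σ_{i<n} (s_{l+i}(a) - s_{l+i}(b))`. [cite: KiKim2000, (3.3)] -/
theorem sum_fourK_iteratedDeriv (F : ℝ → ℝ) (a b : ℝ) (l n : ℕ) :
    ∑ i ∈ Finset.range n, fourK (iteratedDeriv (l + i) F) a b =
      2 * (zeroCount (iteratedDeriv (l + n) F) a b : ℤ) - 2 * (zeroCount (iteratedDeriv l F) a b : ℤ) -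
        ∑ i ∈ Finset.range n, (sFF (iteratedDeriv (l + i) F) a - sFF (iteratedDeriv (l + i) F) b) := by
  induction n with
  | zero => simp
  | succ n ih =>
    rw [Finset.sum_range_succ, Finset.sum_range_succ, ih]
    unfold fourK
    rw [deriv_iteratedDeriv, show l + n + 1 = l + (n + 1) by ring]
    ring


/-! ## Elementary evaluations of `zeroCount` -/

/-- Isolated zeros, quantitatively: a punctured neighbourhood of `a` free of zeros. [folklore] -/
theorem exists_ball_ne_zero (hF : ∀ x, AnalyticAt ℝ F x) (hne : F ≠ 0) (a : ℝ) :
    ∃ δ > 0, ∀ t, |t - a| < δ → t ≠ a → F t ≠ 0 := by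
  rcases (hF a).eventually_eq_zero_or_eventually_ne_zero with h | h
  · exact absurd (analyticOrderAt_eq_top.mpr h) (analyticOrderAt_ne_top_of_ne_zero hF hne a)
  · rw [eventually_nhdsWithin_iff, Metric.eventually_nhds_iff] at h
    obtain ⟨δ, hδ, h⟩ := h
    exact ⟨δ, hδ, fun t ht hta => h (by rwa [Real.dist_eq]) hta⟩

/-- A function without zeros in `[a, b]` has `zeroCount = 0` there. [folklore] -/
theorem zeroCount_eq_zero_of_ne_zero {a b : ℝ} (h : ∀ x ∈ Icc a b, F x ≠ 0) : zeroCount F a b = 0 := by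
  rw [zeroCount_eq_sum (S := ∅) (by simp) (fun x hx hx0 => absurd hx0 (h x hx)), Finset.sum_empty]

/-- Enlarging the interval by zero-free margins does not change `zeroCount`. [folklore] -/
theorem zeroCount_eq_of_subset (hF : ∀ x, AnalyticAt ℝ F x) (hne : F ≠ 0) {a b α β : ℝ}
    (hαa : α ≤ a) (hbβ : b ≤ β) (hl : ∀ x ∈ Ico α a, F x ≠ 0) (hr : ∀ x ∈ Ioc b β, F x ≠ 0) :
    zeroCount F α β = zeroCount F a b := by
  classical
  set S := (finite_zeros_Icc hF hne a b).toFinset with hS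
  have hmem : ∀ x, x ∈ S ↔ x ∈ Icc a b ∧ F x = 0 := fun x => by
    rw [hS, Set.Finite.mem_toFinset]; rfl
  rw [zeroCount_eq_sum (S := S) (fun x hx => ((hmem x).mp hx).1) (fun x hx h0 => (hmem x).mpr ⟨hx, h0⟩),
    zeroCount_eq_sum (S := S)]
  · intro x hx
    obtain ⟨⟨h1, h2⟩, -⟩ := (hmem x).mp hx
    exact ⟨hαa.trans h1, h2.trans hbβ⟩
  · intro x hx h0
    refine (hmem x).mpr ⟨⟨?_, ?_⟩, h0⟩
    · by_contra h; exact hl x ⟨hx.1, not_le.mp h⟩ h0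
    · by_contra h; exact hr x ⟨not_le.mp h, hx.2⟩ h0

/-- A single simple zero: `zeroCount = 1`. [folklore] -/
theorem zeroCount_eq_one {a b t : ℝ} (ht : t ∈ Icc a b)
    (hZ : ∀ x ∈ Icc a b, F x = 0 → x = t) (hord : analyticOrderAt F t = 1) : zeroCount F a b = 1 := by
  rw [zeroCount_eq_sum (S := {t}) (by simpa using ht) (fun x hx h0 => by simpa using hZ x hx h0),
    Finset.sum_singleton]
  simp [analyticOrderNatAt, hord]

/-- The order of `t ↦ t ^ k` at the origin. [folklore] -/
theorem analyticOrderAt_pow_zero (k : ℕ) : analyticOrderAt (fun t : ℝ => t ^ k) 0 = k := by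
  have h : (fun t : ℝ => t ^ k) = ((· - (0:ℝ)) ^ k) := by funext t; simp
  rw [h]; exact analyticOrderAt_centeredMonomial

/-- **Multiplying by `t^k` adds `k` zeros at the origin**: `N_{[0,a]}(t^k F) = k + N_{[0,a]}(F)`. [cite: KiKim2000, (3.6)] -/
theorem zeroCount_pow_mul (hF : ∀ x, AnalyticAt ℝ F x) (hne : F ≠ 0) (k : ℕ) {a : ℝ} (ha : 0 ≤ a) :
    zeroCount (fun t => t ^ k * F t) 0 a = k + zeroCount F 0 a := by
  classical
  have hP : ∀ x, AnalyticAt ℝ (fun t : ℝ => t ^ k) x := fun x => by fun_prop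
  have hPne : (fun t : ℝ => t ^ k) ≠ 0 := by
    intro h; have := congr_fun h 1; simp at this
  set S := insert (0:ℝ) (finite_zeros_Icc hF hne 0 a).toFinset with hS
  have hmem : ∀ x, x ∈ S ↔ x = 0 ∨ (x ∈ Icc 0 a ∧ F x = 0) := fun x => by
    rw [hS, Finset.mem_insert, Set.Finite.mem_toFinset]; rfl
  have hSsub : (↑S : Set ℝ) ⊆ Icc 0 a := by
    intro x hx
    rcases (hmem x).mp hx with rfl | h
    · exact ⟨le_rfl, ha⟩
    · exact h.1
  rw [zeroCount_eq_sum (S := S) hSsub, zeroCount_eq_sum (S := S) hSsub]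
  · have hsplit : ∀ x ∈ S, analyticOrderNatAt (fun t => t ^ k * F t) x =
        analyticOrderNatAt (fun t : ℝ => t ^ k) x + analyticOrderNatAt F x := by
      intro x _
      exact analyticOrderNatAt_mul (hP x) (hF x) (analyticOrderAt_ne_top_of_ne_zero hP hPne x)
        (analyticOrderAt_ne_top_of_ne_zero hF hne x)
    rw [Finset.sum_congr rfl hsplit, Finset.sum_add_distrib]
    congr 1
    have h0S : (0:ℝ) ∈ S := (hmem 0).mpr (Or.inl rfl)
    rw [← Finset.add_sum_erase S _ h0S, Finset.sum_eq_zero, add_zero]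
    · simp [analyticOrderNatAt, analyticOrderAt_pow_zero]
    · intro x hx
      have hx0 : x ≠ 0 := (Finset.mem_erase.mp hx).1
      simp [analyticOrderNatAt, (hP x).analyticOrderAt_eq_zero.mpr (pow_ne_zero k hx0)]
  · intro x hx h0; exact (hmem x).mpr (Or.inr ⟨hx, h0⟩)
  · intro x hx h0
    rcases mul_eq_zero.mp h0 with h | h
    · exact (hmem x).mpr (Or.inl (pow_eq_zero_iff'.mp h).1)
    · exact (hmem x).mpr (Or.inr ⟨hx, h⟩)

/-- **Rolle's theorem with multiplicities** (from `fourK ≥ 0`): if `F, F'` do not vanish at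
`a < b` then `N_{[a,b]}(F) ≤ N_{[a,b]}(F') + 1`. [folklore] -/
theorem zeroCount_le_zeroCount_deriv_add_one (hF : ∀ x, AnalyticAt ℝ F x) (hF' : deriv F ≠ 0)
    {a b : ℝ} (hab : a < b) (ha : F a ≠ 0) (ha' : deriv F a ≠ 0) (hb : F b ≠ 0)
    (hb' : deriv F b ≠ 0) : (zeroCount F a b : ℤ) ≤ zeroCount (deriv F) a b + 1 := by
  have h := (fourK_nonneg_dvd_iff hF hF' hab ha ha' hb hb').1
  unfold fourK sFF at h
  have h1 := signType_coe_int_eq_or _ (sign_ne_zero.mpr (mul_ne_zero ha ha'))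
  have h2 := signType_coe_int_eq_or _ (sign_ne_zero.mpr (mul_ne_zero hb hb'))
  rcases h1 with h1 | h1 <;> rcases h2 with h2 | h2 <;> rw [h1, h2] at h <;> omega


/-! ## Level `l` form -/

/-- Iterated derivatives of an everywhere-analytic function are everywhere analytic. [folklore] -/
theorem analyticAt_iteratedDeriv (hF : ∀ x, AnalyticAt ℝ F x) (n : ℕ) (x : ℝ) :
    AnalyticAt ℝ (iteratedDeriv n F) x := by
  induction n generalizing x with
  | zero => simpa using hF x
  | succ n ih => rw [iteratedDeriv_succ]; exact (ih x).deriv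

/-- The structure theorem at level `l`: `fourK (F^{(l)})` on `[a, b]` is `≥ 0`, divisible by `4`,
and `= 0` iff every zero `c ∈ (a,b)` of `F^{(l+1)}` with `F^{(l)}(c) ≠ 0` has
`F^{(l)}(c) F^{(l+2)}(c) < 0`. [cite: KiKim2000, (3.1)] -/
theorem fourK_iteratedDeriv_nonneg_dvd_iff (hF : ∀ x, AnalyticAt ℝ F x) (l : ℕ)
    (hF' : iteratedDeriv (l + 1) F ≠ 0) {a b : ℝ} (hab : a < b) (ha : iteratedDeriv l F a ≠ 0)
    (ha' : iteratedDeriv (l + 1) F a ≠ 0) (hb : iteratedDeriv l F b ≠ 0)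
    (hb' : iteratedDeriv (l + 1) F b ≠ 0) :
    0 ≤ fourK (iteratedDeriv l F) a b ∧ 4 ∣ fourK (iteratedDeriv l F) a b ∧
      (fourK (iteratedDeriv l F) a b = 0 ↔ ∀ c ∈ Ioo a b, iteratedDeriv (l + 1) F c = 0 →
        iteratedDeriv l F c ≠ 0 → iteratedDeriv l F c * iteratedDeriv (l + 2) F c < 0) := by
  have hG := analyticAt_iteratedDeriv hF l
  rw [← deriv_iteratedDeriv] at hF' ha' hb'
  have h := fourK_nonneg_dvd_iff hG hF' hab ha ha' hb hb'
  simp only [deriv_iteratedDeriv] at h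
  exact h

end KiKim
end Literature.Analysis.Complex
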